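import Summits.AtomisticToContinuum.HydrodynamicLimit.Theorems.RelayRaceLocalityLightConeInLawSVCLine
import Summits.AtomisticToContinuum.HydrodynamicLimit.Theorems.RelayRaceLocalityNearConstantShortTimeHLGeneralGibbs
import Literature.Analysis.FluidPDE.HardSphereUniqueness
import Literature.Analysis.FluidPDE.BBGKYMarginalsPartitionProofs

/-!
# Line `susceptibility-variance-continuity` for the crux `LightConeInLaw` (stmt-AtomisticToContinuum-12500):
reduction of the dynamic input `stub_var` to a Poissonised mean-square fluctuation bound

Support file (`--supports stmt-AtomisticToContinuum-12500`) of the line lead a1 (worker `stub_var`), line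
`susceptibility-variance-continuity` (skeleton `Cruxes/LightConeInLaw/Lines/susceptibility_variance_continuity.lean`,
rev 2; vocabulary `Theorems/RelayRaceLocalityLightConeInLawSVCLine.lean`). The registered stub `stub_var` (the
line's ONE DYNAMIC INPUT) asserts, on the mean-count window of the Poissonised canonical family
`p_{N,μ}(n) ∝ μⁿ Z_{N,n}/n!` of the comparison gas, the CLT-rate bound
`(N+1) · Var_{p_{N,μ}}(n ↦ E_{π_{N,n}} F(reduced fields of Ψ_t z against χ)) ≤ C` for bounded `1`-Lipschitz `F`.
It is OPEN for the deterministic hard-sphere gas at `t > 0`. This file records what IS provable today: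

* `canonicalMean_flow_congr` — the canonical time-`t` means `g(n)` do NOT depend on which `HardSphereFlow`
  structure is used (a.e. uniqueness of the hard-sphere flow, `HardSphereFlow.flow_eq_ae_holds`, GST 2013
  Prop. 4.1.1, + absolute continuity of the canonical law): the universally quantified flow family `Ψ N n` of
  `stub_var` cannot be chosen adversarially;
* `canonicalMean_flow_zero` — at `t = 0` the means are static (`Φ₀ = id` on the conull good set);
* `hasSum_countWeight`, `countWeight_nonneg`, `isProbabilityMeasure_of_countWeight_pos`,
  `particleLaw_canonical_univ_le_one` — the Poissonised count law is a probability law on `ℕ` (weights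
  `Z_{N,n}/n! ≤ Aⁿ/n!`, `Z_{N,0} = 1`), and a particle number of positive weight has a canonical PROBABILITY law;
* `wVar_canonicalMean_le_of_msq` (registered helper) — **the rev 1 ⟹ rev 2 reduction, kernel-checked**: for any
  measurable observables `X n`, any `1`-Lipschitz `|F| ≤ 1` and ANY centre `c`,
  `Var_{p_{N,ν}}(n ↦ E_{π_{N,n}} F(X n)) ≤ Σₙ p_{N,ν}(n) E_{π_{N,n}} dist(X n, c)²` (law of total variance in the
  form `Var(E[F(X)|K]) ≤ E (F(X) − F(c))² ≤ E dist(X,c)²`; the right-hand side is stated junk-free with `∫⁻` and an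
  `ℝ≥0∞`-valued series). Hence `stub_var` follows from the Poissonised (grand-canonical) MEAN-SQUARE fluctuation
  bound `Σₙ p(n) E_{π_{N,n}} dist(X_{n,t}, c_N)² ≤ C/(N+1)` of the three reduced hydrodynamic fields at time `t`
  — at `t = 0` a static cluster-expansion fact about the low-activity hard-sphere gas (truncated two-point function
  summable uniformly in the volume; in print, not in the tree, whose canonical two-point limit
  `SmallDensity.tendsto_twoPt` is qualitative), at `t > 0` the open "bounded `L²` amplification of fluctuations by
  the deterministic dynamics" (Spohn 1991 Part II §7.1).

References: I. Gallagher, L. Saint-Raymond, B. Texier, *From Newton to Boltzmann* (2013) Prop. 4.1.1;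
H. Spohn, *Large Scale Dynamics of Interacting Particles* (1991) Part I §2.3, Part II §7.1;
J. L. Lebowitz, J. K. Percus, L. Verlet, Phys. Rev. 153 (1967) 250 (ensemble corrections `O(1/N)`).
-/

namespace Summit.AtomisticToContinuum.HydrodynamicLimit.Theorems.LightConeInLawSVC.Var

open scoped BigOperators Topology Classical ENNReal
open Filter Set MeasureTheory
open Literature.MathematicalPhysics.KineticTheory Literature.Analysis.FluidPDE Literature.Analysis.FunctionSpaces
open Summit.AtomisticToContinuum.HydrodynamicLimit.Theorems.LightConeInLawSketch
open Summit.AtomisticToContinuum.HydrodynamicLimit.Theorems.LightConeInLawSVC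

noncomputable section

/-! ### The flow is immaterial: canonical means do not depend on the chosen `HardSphereFlow` -/

/-- **Canonical time-`t` means do not depend on the hard-sphere flow used** (two `HardSphereFlow`
structures with the same parameters agree Liouville-a.e. at every time, `HardSphereFlow.flow_eq_ae_holds`,
and the canonical law is absolutely continuous with respect to the Liouville measure). [folklore] -/
theorem canonicalMean_flow_congr (σ₁ : ℝ) (f : T3 × V3 → ℝ) (N n : ℕ)
    (Ψ Ψ' : HardSphereFlow G3 (hsDiameter σ₁ N) n) (t : ℝ) (O : Config n (Fin 3) T3 → ℝ) :
    canonicalMean σ₁ f N n Ψ (fun z => O (Ψ.flow t z)) =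
      canonicalMean σ₁ f N n Ψ' (fun z => O (Ψ'.flow t z)) := by
  unfold canonicalMean
  rw [particleLaw_eq, particleLaw_eq]
  refine integral_congr_ae ?_
  have hae : Ψ.flow t =ᵐ[liouville G3 n (hsDiameter σ₁ N)] Ψ'.flow t :=
    HardSphereFlow.flow_eq_ae_holds Ψ Ψ' t
  have hac : (liouville G3 n (hsDiameter σ₁ N)).withDensity (fun z => ENNReal.ofReal
      (canonicalDensity G3 (hsDiameter σ₁ N) n f z)) ≪ liouville G3 n (hsDiameter σ₁ N) :=
    withDensity_absolutelyContinuous _ _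
  filter_upwards [hac.ae_le hae] with z hz
  rw [hz]

/-- **At `t = 0` canonical means are static**: `Φ₀ = id` on the good set, which is Liouville-conull. [folklore] -/
theorem canonicalMean_flow_zero (σ₁ : ℝ) (f : T3 × V3 → ℝ) (N n : ℕ)
    (Ψ : HardSphereFlow G3 (hsDiameter σ₁ N) n) (O : Config n (Fin 3) T3 → ℝ) :
    canonicalMean σ₁ f N n Ψ (fun z => O (Ψ.flow 0 z)) = canonicalMean σ₁ f N n Ψ O := by
  unfold canonicalMean
  rw [particleLaw_eq]
  refine integral_congr_ae ?_
  have hac : (liouville G3 n (hsDiameter σ₁ N)).withDensity (fun z => ENNReal.ofReal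
      (canonicalDensity G3 (hsDiameter σ₁ N) n f z)) ≪ liouville G3 n (hsDiameter σ₁ N) :=
    withDensity_absolutelyContinuous _ _
  filter_upwards [hac.ae_le Ψ.ae_mem_good] with z hz
  rw [Ψ.flow_zero z hz]


/-! ### The Poissonised count law: nonnegative weights of unit mass -/

section Weights

variable {a θ : T3 → ℝ} {u : T3 → V3}

/-- `Z_{N,n} ≤ Aⁿ` for a local Gibbs profile with activity `0 ≤ a ≤ A` (the Maxwellians integrate to one,
`canonicalPartition_eq_posPartition`, and `∏ a(xᵢ) ≤ Aⁿ` on the unit-volume torus). [folklore] -/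
theorem canonicalPartition_localGibbs_le_pow (ha : Continuous a) (hθ : Continuous θ) (hu : Continuous u)
    (ha0 : ∀ x, 0 ≤ a x) (hθ0 : ∀ x, 0 < θ x) {A : ℝ} (hA : ∀ x, a x ≤ A) (ε : ℝ) (n : ℕ) :
    canonicalPartition G3 ε n (localGibbsProfile a u θ) ≤ A ^ n := by
  rw [show G3 = Torus.geometry (Fin 3) from rfl, canonicalPartition_eq_posPartition ha hθ hu ha0 hθ0 ε n]
  calc posPartition a ε n = ∫ x, posWeight a ε n x := rfl
    _ ≤ ∫ _x : Fin n → T3, A ^ n := integral_mono (integrable_posWeight ha ha0 ε n) (integrable_const _)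
        (fun x => posWeight_le_pow ha0 hA ε x)
    _ = A ^ n := by simp

/-- The canonical weights `Z_{N,n}/n!` are nonnegative. [folklore] -/
theorem canonicalWeights_nonneg (ha0 : ∀ x, 0 ≤ a x) (hθ0 : ∀ x, 0 ≤ θ x) (σ₁ : ℝ) (N n : ℕ) :
    0 ≤ canonicalWeights σ₁ (localGibbsProfile a u θ) N n :=
  div_nonneg (Literature.MathematicalPhysics.KineticTheory.canonicalPartition_nonneg _ _ _
    (localGibbsProfile_nonneg ha0 hθ0)) (Nat.cast_nonneg _)

/-- The zeroth canonical weight is `1` (`Z_{N,0} = 1`). [folklore] -/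
theorem canonicalWeights_zero (σ₁ : ℝ) (f : T3 × V3 → ℝ) (N : ℕ) : canonicalWeights σ₁ f N 0 = 1 := by
  simp [canonicalWeights, canonicalPartition_zero_eq_one]

/-- The generating series `Σₙ (Z_{N,n}/n!) νⁿ` converges for `ν ≥ 0` (domination by `Σ (Aν)ⁿ/n! = e^{Aν}`).
[folklore] -/
theorem summable_canonicalWeights_mul_pow (ha : Continuous a) (hθ : Continuous θ) (hu : Continuous u)
    (ha0 : ∀ x, 0 ≤ a x) (hθ0 : ∀ x, 0 < θ x) (σ₁ : ℝ) (N : ℕ) {ν : ℝ} (hν : 0 ≤ ν) :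
    Summable fun n => canonicalWeights σ₁ (localGibbsProfile a u θ) N n * ν ^ n := by
  obtain ⟨A, -, hA⟩ := exists_forall_abs_le_of_continuous ha
  have hA' : ∀ x, a x ≤ A := fun x => (le_abs_self _).trans (hA x)
  refine (Real.summable_pow_div_factorial (A * ν)).of_nonneg_of_le
    (fun n => mul_nonneg (canonicalWeights_nonneg ha0 (fun x => (hθ0 x).le) σ₁ N n) (pow_nonneg hν n))
    (fun n => ?_)
  unfold canonicalWeights
  rw [div_mul_eq_mul_div, mul_pow]
  exact div_le_div_of_nonneg_right (mul_le_mul_of_nonneg_right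
    (canonicalPartition_localGibbs_le_pow ha hθ hu ha0 hθ0 hA' _ n) (pow_nonneg hν n)) (Nat.cast_nonneg _)

/-- The partition sum of the canonical weights is positive for `ν ≥ 0` (its zeroth term is `1`). [folklore] -/
theorem wZ_canonicalWeights_pos (ha : Continuous a) (hθ : Continuous θ) (hu : Continuous u)
    (ha0 : ∀ x, 0 ≤ a x) (hθ0 : ∀ x, 0 < θ x) (σ₁ : ℝ) (N : ℕ) {ν : ℝ} (hν : 0 ≤ ν) :
    0 < wZ (canonicalWeights σ₁ (localGibbsProfile a u θ) N) ν := by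
  unfold wZ
  refine (summable_canonicalWeights_mul_pow ha hθ hu ha0 hθ0 σ₁ N hν).tsum_pos
    (fun n => mul_nonneg (canonicalWeights_nonneg ha0 (fun x => (hθ0 x).le) σ₁ N n) (pow_nonneg hν n)) 0 ?_
  simp [canonicalWeights_zero]

/-- The Poissonised count law has nonnegative weights. [folklore] -/
theorem countWeight_nonneg (ha : Continuous a) (hθ : Continuous θ) (hu : Continuous u)
    (ha0 : ∀ x, 0 ≤ a x) (hθ0 : ∀ x, 0 < θ x) (σ₁ : ℝ) (N n : ℕ) {ν : ℝ} (hν : 0 ≤ ν) :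
    0 ≤ countWeight σ₁ (localGibbsProfile a u θ) ν N n :=
  div_nonneg (mul_nonneg (canonicalWeights_nonneg ha0 (fun x => (hθ0 x).le) σ₁ N n) (pow_nonneg hν n))
    (wZ_canonicalWeights_pos ha hθ hu ha0 hθ0 σ₁ N hν).le

/-- **The Poissonised count law is a probability law on `ℕ`**: `Σₙ p_{N,ν}(n) = 1`. [folklore] -/
theorem hasSum_countWeight (ha : Continuous a) (hθ : Continuous θ) (hu : Continuous u)
    (ha0 : ∀ x, 0 ≤ a x) (hθ0 : ∀ x, 0 < θ x) (σ₁ : ℝ) (N : ℕ) {ν : ℝ} (hν : 0 ≤ ν) :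
    HasSum (fun n => countWeight σ₁ (localGibbsProfile a u θ) ν N n) 1 := by
  have hs := summable_canonicalWeights_mul_pow ha hθ hu ha0 hθ0 σ₁ N hν (u := u)
  have hZ := wZ_canonicalWeights_pos ha hθ hu ha0 hθ0 σ₁ N hν (u := u)
  have h : HasSum (fun n => canonicalWeights σ₁ (localGibbsProfile a u θ) N n * ν ^ n /
      wZ (canonicalWeights σ₁ (localGibbsProfile a u θ) N) ν)
      (wZ (canonicalWeights σ₁ (localGibbsProfile a u θ) N) ν /
        wZ (canonicalWeights σ₁ (localGibbsProfile a u θ) N) ν) := hs.hasSum.div_const _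
  rw [div_self hZ.ne'] at h
  exact h

/-- **A particle number of positive Poissonised weight has a canonical PROBABILITY law** (`p(n) > 0` forces
`Z_{N,n} > 0`, i.e. `n` spheres fit; then the canonical law is normalised). [folklore] -/
theorem isProbabilityMeasure_of_countWeight_pos (ha : Continuous a) (hθ : Continuous θ) (hu : Continuous u)
    (ha0 : ∀ x, 0 ≤ a x) (hθ0 : ∀ x, 0 < θ x) {σ₁ ν : ℝ} {N n : ℕ} (hν : 0 ≤ ν)
    (Ψ : HardSphereFlow G3 (hsDiameter σ₁ N) n)
    (hp : 0 < countWeight σ₁ (localGibbsProfile a u θ) ν N n) :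
    IsProbabilityMeasure
      (particleLaw Ψ (canonicalDensity G3 (hsDiameter σ₁ N) n (localGibbsProfile a u θ))) := by
  obtain ⟨A, -, hA⟩ := exists_forall_abs_le_of_continuous ha
  have hA' : ∀ x, a x ≤ A := fun x => (le_abs_self _).trans (hA x)
  have hZ := wZ_canonicalWeights_pos ha hθ hu ha0 hθ0 σ₁ N hν (u := u)
  have hw : 0 < canonicalWeights σ₁ (localGibbsProfile a u θ) N n := by
    by_contra h
    push Not at h
    have : countWeight σ₁ (localGibbsProfile a u θ) ν N n ≤ 0 :=
      div_nonpos_of_nonpos_of_nonneg (mul_nonpos_of_nonpos_of_nonneg h (pow_nonneg hν n)) hZ.le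
    linarith
  have hZn : 0 < canonicalPartition G3 (hsDiameter σ₁ N) n (localGibbsProfile a u θ) := by
    have h := mul_pos hw (Nat.cast_pos.2 (Nat.factorial_pos n) : (0 : ℝ) < (n.factorial : ℝ))
    unfold canonicalWeights at h
    rwa [div_mul_cancel₀ _ (Nat.cast_ne_zero.2 (Nat.factorial_ne_zero n))] at h
  rw [show G3 = Torus.geometry (Fin 3) from rfl, canonicalPartition_eq_posPartition ha hθ hu ha0 hθ0] at hZn
  rw [particleLaw_eq, show G3 = Torus.geometry (Fin 3) from rfl,
    NearConstantShortTimeHL.liouville_withDensity_canonicalDensity]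
  exact NearConstantShortTimeHL.isProbabilityMeasure_canonicalLaw ha.measurable hθ.measurable hu.measurable
    ha0 hA' hθ0 hZn

/-- **Canonical laws are sub-probabilities** (mass `Z⁻¹ · Z ∈ {0, 1}`). [folklore] -/
theorem particleLaw_canonical_univ_le_one (ha : Continuous a) (hθ : Continuous θ) (hu : Continuous u)
    (ha0 : ∀ x, 0 ≤ a x) (hθ0 : ∀ x, 0 < θ x) {ε : ℝ} {n : ℕ} (Ψ : HardSphereFlow G3 ε n) :
    particleLaw Ψ (canonicalDensity G3 ε n (localGibbsProfile a u θ)) univ ≤ 1 := by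
  obtain ⟨A, -, hA⟩ := exists_forall_abs_le_of_continuous ha
  have hA' : ∀ x, a x ≤ A := fun x => (le_abs_self _).trans (hA x)
  rw [particleLaw_eq, show G3 = Torus.geometry (Fin 3) from rfl,
    NearConstantShortTimeHL.liouville_withDensity_canonicalDensity,
    NearConstantShortTimeHL.canonicalLaw_univ ha.measurable hθ.measurable hu.measurable ha0 hA' hθ0 ε n,
    ← ENNReal.ofReal_mul (inv_nonneg.2 (posPartition_nonneg ha0 _ _)), ← ENNReal.ofReal_one]
  refine ENNReal.ofReal_le_ofReal ?_
  by_cases hZ : posPartition a ε n = 0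
  · simp [hZ]
  · rw [inv_mul_cancel₀ hZ]

end Weights

/-! ### Two elementary second-moment inequalities -/

/-- **Variance against an arbitrary centre.** For probability weights `p ≥ 0`, `Σ p = 1`, a bounded sequence `g`
and any `a`: `Σ p g² − (Σ p g)² ≤ Σ p (g − a)²` — the difference is `(Σ p g − a)²`. [folklore] -/
theorem tsum_sq_sub_sq_tsum_le {p g : ℕ → ℝ} (hp0 : ∀ n, 0 ≤ p n) (hp : HasSum p 1) {B : ℝ}
    (hg : ∀ n, |g n| ≤ B) (a : ℝ) :
    ∑' n, p n * g n ^ 2 - (∑' n, p n * g n) ^ 2 ≤ ∑' n, p n * (g n - a) ^ 2 := by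
  have hsp : Summable p := hp.summable
  have hB : 0 ≤ B := (abs_nonneg _).trans (hg 0)
  have hs1 : Summable fun n => p n * g n := by
    refine (hsp.mul_left B).of_norm_bounded fun n => ?_
    rw [Real.norm_eq_abs, abs_mul, abs_of_nonneg (hp0 n), mul_comm]
    exact mul_le_mul_of_nonneg_right (hg n) (hp0 n)
  have hs2 : Summable fun n => p n * g n ^ 2 := by
    refine (hsp.mul_left (B ^ 2)).of_norm_bounded fun n => ?_
    rw [Real.norm_eq_abs, abs_mul, abs_of_nonneg (hp0 n), mul_comm, abs_pow, ← sq_abs B]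
    exact mul_le_mul_of_nonneg_right (pow_le_pow_left₀ (abs_nonneg _) ((hg n).trans (le_abs_self B)) 2)
      (hp0 n)
  have key : ∑' n, p n * (g n - a) ^ 2 =
      ∑' n, p n * g n ^ 2 - 2 * a * ∑' n, p n * g n + a ^ 2 := by
    have h : ∀ n, p n * (g n - a) ^ 2 = (p n * g n ^ 2 - 2 * a * (p n * g n)) + a ^ 2 * p n := fun n => by
      ring
    simp_rw [h]
    rw [(hs2.sub (hs1.mul_left _)).tsum_add (hsp.mul_left _), hs2.tsum_sub (hs1.mul_left _),
      tsum_mul_left, tsum_mul_left, hp.tsum_eq, mul_one]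
  rw [key]
  nlinarith [sq_nonneg (∑' n, p n * g n - a)]

/-- **`(∫ h)² ≤ ∫ h²` on a probability space**, for a bounded (a.e. strongly) measurable `h`: the difference is
the variance `∫ (h − ∫ h)² ≥ 0`. [folklore] -/
theorem sq_integral_le_integral_sq {Ω : Type*} [MeasurableSpace Ω] (P : Measure Ω) [IsProbabilityMeasure P]
    {h : Ω → ℝ} (hm : AEStronglyMeasurable h P) {C : ℝ} (hC : ∀ ω, |h ω| ≤ C) :
    (∫ ω, h ω ∂P) ^ 2 ≤ ∫ ω, h ω ^ 2 ∂P := by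
  set m := ∫ ω, h ω ∂P with hm_def
  have hi : Integrable h P :=
    Integrable.of_bound hm C (ae_of_all _ fun ω => by rw [Real.norm_eq_abs]; exact hC ω)
  have hi2 : Integrable (fun ω => h ω ^ 2) P := by
    refine Integrable.of_bound (hm.pow 2) (C ^ 2) (ae_of_all _ fun ω => ?_)
    rw [Real.norm_eq_abs, abs_pow, ← sq_abs C]
    exact pow_le_pow_left₀ (abs_nonneg _) ((hC ω).trans (le_abs_self C)) 2
  have h0 : 0 ≤ ∫ ω, (h ω - m) ^ 2 ∂P := integral_nonneg fun ω => sq_nonneg _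
  have hexp : ∫ ω, (h ω - m) ^ 2 ∂P = ∫ ω, h ω ^ 2 ∂P - m ^ 2 := by
    have h' : ∀ ω, (h ω - m) ^ 2 = (h ω ^ 2 - 2 * m * h ω) + m ^ 2 := fun ω => by ring
    simp_rw [h']
    have hA : Integrable (fun ω => h ω ^ 2 - 2 * m * h ω) P := hi2.sub (hi.const_mul _)
    have hB : Integrable (fun ω => 2 * m * h ω) P := hi.const_mul _
    rw [integral_add hA (integrable_const _), integral_sub hi2 hB, integral_const_mul, integral_const]
    simp only [probReal_univ, one_smul]
    rw [← hm_def]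
    ring
  linarith

/-! ### The reduction: count-conditional variance ≤ Poissonised mean-square fluctuation -/

/-- **COUNT-CONDITIONAL VARIANCE IS DOMINATED BY THE POISSONISED MEAN-SQUARE FLUCTUATION** (the rev 1 ⟹ rev 2
reduction of the line's dynamic input `stub_var`, kernel-checked). For the Poissonised canonical family of the
hard-sphere gas with a continuous local Gibbs profile `(a ≥ 0, u, θ > 0)` at activity `ν > 0`, a family of
measurable observables `X n` of the `n`-sphere configurations with values in a metric space, a `1`-Lipschitz `F`
with `|F| ≤ 1`, ANY centre `c` and `B ≥ 0`: if the Poissonised mean square distance of `X` from `c` is `≤ B`,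
`Σₙ p_{N,ν}(n) · E_{π_{N,n}} dist(X n, c)² ≤ B` (stated junk-free with `∫⁻` and an `ℝ≥0∞`-valued series), then the
variance under the count law `p_{N,ν}` of the canonical expectations `g(n) = E_{π_{N,n}} F(X n)` is `≤ B`:
`Σₙ p g² − (Σₙ p g)² ≤ B`. Proof: `Σ p = 1` (`hasSum_countWeight`); `Var_p(g) ≤ Σ p (g − F c)²`
(`tsum_sq_sub_sq_tsum_le`); for `p(n) > 0` the canonical law is a probability measure
(`isProbabilityMeasure_of_countWeight_pos`), so `(g n − F c)² = (E[F∘X − F c])² ≤ E[(F∘X − F c)²] ≤ E[dist(X,c)²]`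
(Jensen `sq_integral_le_integral_sq`, Lipschitz); sum. With `X n z = ` the reduced field triple of
`(Ψ n).flow t z` against `χ` this is exactly the inequality `stub_var` asserts, from the mean-square bound that the
physics literature states (bounded `L²` fluctuations of the hydrodynamic fields). [folklore] -/
theorem wVar_canonicalMean_le_of_msq' {a θ : T3 → ℝ} {u : T3 → V3}
    (ha : Continuous a) (hθ : Continuous θ) (hu : Continuous u) (ha0 : ∀ x, 0 ≤ a x) (hθ0 : ∀ x, 0 < θ x)
    {E : Type*} [PseudoMetricSpace E] [MeasurableSpace E] [OpensMeasurableSpace E]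
    (σ₁ : ℝ) (N : ℕ) (Ψ : (n : ℕ) → HardSphereFlow G3 (hsDiameter σ₁ N) n) {ν : ℝ} (hν : 0 < ν)
    (X : (n : ℕ) → Config n (Fin 3) T3 → E) (hX : ∀ n, Measurable (X n))
    {F : E → ℝ} (hF : LipschitzWith 1 F) (hFb : ∀ e, |F e| ≤ 1) (c : E) {B : ℝ} (hB : 0 ≤ B)
    (hmsq : ∑' n, ENNReal.ofReal (countWeight σ₁ (localGibbsProfile a u θ) ν N n) *
        ∫⁻ z, ENNReal.ofReal (dist (X n z) c ^ 2)
          ∂(particleLaw (Ψ n) (canonicalDensity G3 (hsDiameter σ₁ N) n (localGibbsProfile a u θ))) ≤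
      ENNReal.ofReal B) :
    wMean (canonicalWeights σ₁ (localGibbsProfile a u θ) N)
        (fun n => canonicalMean σ₁ (localGibbsProfile a u θ) N n (Ψ n) (fun z => F (X n z)) ^ 2) ν -
      wMean (canonicalWeights σ₁ (localGibbsProfile a u θ) N)
        (fun n => canonicalMean σ₁ (localGibbsProfile a u θ) N n (Ψ n) (fun z => F (X n z))) ν ^ 2 ≤ B := by
  set f := localGibbsProfile a u θ with hf_def
  set p : ℕ → ℝ := fun n => countWeight σ₁ f ν N n with hp_def
  set P : (n : ℕ) → Measure (Config n (Fin 3) T3) := fun n =>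
    particleLaw (Ψ n) (canonicalDensity G3 (hsDiameter σ₁ N) n f) with hP_def
  set g : ℕ → ℝ := fun n => canonicalMean σ₁ f N n (Ψ n) (fun z => F (X n z)) with hg_def
  set L : ℕ → ℝ≥0∞ := fun n => ∫⁻ z, ENNReal.ofReal (dist (X n z) c ^ 2) ∂P n with hL_def
  have hmsq' : ∑' n, ENNReal.ofReal (p n) * L n ≤ ENNReal.ofReal B := hmsq
  have hp0 : ∀ n, 0 ≤ p n := fun n => countWeight_nonneg ha hθ hu ha0 hθ0 σ₁ N n hν.le
  have hp1 : HasSum p 1 := hasSum_countWeight ha hθ hu ha0 hθ0 σ₁ N hν.le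
  have hFX : ∀ n, Measurable fun z => F (X n z) := fun n => hF.continuous.measurable.comp (hX n)
  -- `|g n| ≤ 1` (sub-probability laws, `|F| ≤ 1`)
  have hg1 : ∀ n, |g n| ≤ 1 := by
    intro n
    have hfin : P n univ ≤ 1 := particleLaw_canonical_univ_le_one ha hθ hu ha0 hθ0 (Ψ n)
    haveI : IsFiniteMeasure (P n) := ⟨hfin.trans_lt ENNReal.one_lt_top⟩
    have hreal : (P n).real univ ≤ 1 := by
      rw [measureReal_def]
      exact ENNReal.toReal_le_of_le_ofReal zero_le_one (by rwa [ENNReal.ofReal_one])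
    calc |g n| = ‖∫ z, F (X n z) ∂P n‖ := (Real.norm_eq_abs _).symm
      _ ≤ 1 * (P n).real univ :=
          norm_integral_le_of_norm_le_const (ae_of_all _ fun z => by rw [Real.norm_eq_abs]; exact hFb _)
      _ ≤ 1 := by rw [one_mul]; exact hreal
  -- Step 1: variance against the centre `F c`
  have h1 := tsum_sq_sub_sq_tsum_le hp0 hp1 hg1 (F c)
  -- Step 2: termwise Jensen + Lipschitz
  have hterm_ne_top : ∀ n, ENNReal.ofReal (p n) * L n ≠ ⊤ := fun n =>
    ne_top_of_le_ne_top ENNReal.ofReal_ne_top ((ENNReal.le_tsum n).trans hmsq')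
  have h2 : ∀ n, p n * (g n - F c) ^ 2 ≤ (ENNReal.ofReal (p n) * L n).toReal := by
    intro n
    rcases (hp0 n).eq_or_lt with hpz | hpos
    · rw [← hpz]
      simp
    · haveI : IsProbabilityMeasure (P n) :=
        isProbabilityMeasure_of_countWeight_pos ha hθ hu ha0 hθ0 hν.le (Ψ n) hpos
      have hLfin : L n ≠ ⊤ := by
        intro hL
        apply hterm_ne_top n
        rw [hL, ENNReal.mul_top (ENNReal.ofReal_pos.2 hpos).ne']
      rw [ENNReal.toReal_mul, ENNReal.toReal_ofReal (hp0 n)]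
      refine mul_le_mul_of_nonneg_left ?_ (hp0 n)
      have hint : Integrable (fun z => F (X n z)) (P n) :=
        Integrable.of_bound (hFX n).aestronglyMeasurable 1
          (ae_of_all _ fun z => by rw [Real.norm_eq_abs]; exact hFb _)
      have hsub : g n - F c = ∫ z, (F (X n z) - F c) ∂P n := by
        rw [integral_sub hint (integrable_const _), integral_const]
        simp [hg_def, canonicalMean, hP_def, hf_def]
      have hbd : ∀ z, |F (X n z) - F c| ≤ dist (X n z) c := fun z => by
        rw [← Real.dist_eq]
        exact hF.dist_le_mul_of_le le_rfl |>.trans_eq (by simp)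
      calc (g n - F c) ^ 2 = (∫ z, (F (X n z) - F c) ∂P n) ^ 2 := by rw [hsub]
        _ ≤ ∫ z, (F (X n z) - F c) ^ 2 ∂P n :=
            sq_integral_le_integral_sq (P n) ((hFX n).sub measurable_const).aestronglyMeasurable (C := 2)
              (fun z => (abs_sub _ _).trans (by linarith [hFb (X n z), hFb c]))
        _ ≤ (L n).toReal := by
            have hm2 : AEStronglyMeasurable (fun z => (F (X n z) - F c) ^ 2) (P n) :=
              (((hFX n).sub measurable_const).pow_const 2).aestronglyMeasurable
            rw [integral_eq_lintegral_of_nonneg_ae (ae_of_all _ fun z => sq_nonneg _) hm2]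
            refine ENNReal.toReal_mono hLfin (lintegral_mono fun z => ENNReal.ofReal_le_ofReal ?_)
            calc (F (X n z) - F c) ^ 2 = |F (X n z) - F c| ^ 2 := (sq_abs _).symm
              _ ≤ dist (X n z) c ^ 2 := pow_le_pow_left₀ (abs_nonneg _) (hbd z) 2
  -- Step 3: sum up
  have hsumv : Summable fun n => (ENNReal.ofReal (p n) * L n).toReal :=
    ENNReal.summable_toReal (ne_top_of_le_ne_top ENNReal.ofReal_ne_top hmsq')
  have hsumu : Summable fun n => p n * (g n - F c) ^ 2 :=
    hsumv.of_nonneg_of_le (fun n => mul_nonneg (hp0 n) (sq_nonneg _)) h2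
  have h3 : ∑' n, p n * (g n - F c) ^ 2 ≤ B :=
    calc ∑' n, p n * (g n - F c) ^ 2 ≤ ∑' n, (ENNReal.ofReal (p n) * L n).toReal :=
          hsumu.tsum_le_tsum h2 hsumv
      _ = (∑' n, ENNReal.ofReal (p n) * L n).toReal := (ENNReal.tsum_toReal_eq hterm_ne_top).symm
      _ ≤ B := ENNReal.toReal_le_of_le_ofReal hB hmsq'
  -- conclude
  change ∑' n, p n * g n ^ 2 - (∑' n, p n * g n) ^ 2 ≤ B
  linarith [h1, h3]

/-- **Registered helper `wVar_canonicalMean_le_of_msq` (line `susceptibility-variance-continuity`, toward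
`stub_var`): COUNT-CONDITIONAL VARIANCE ≤ POISSONISED MEAN-SQUARE FLUCTUATION**, for observables with values in
`ℝ × V3 × ℝ` (the reduced field triple of `stub_var`): `wVar_canonicalMean_le_of_msq'` in closed `∀`-form. With
`X n z := (σ₂³ ρ_n(χ)(Ψₜz), σ₂³ • j_n(χ)(Ψₜz), σ₂³ e_n(χ)(Ψₜz))` and `B := C/(N+1)` its conclusion is the inequality of
`stub_var` at `(μ, N)`. [folklore] -/
theorem wVar_canonicalMean_le_of_msq :
    ∀ (a θ : T3 → ℝ) (u : T3 → V3), Continuous a → Continuous θ → Continuous u →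
      (∀ x, 0 ≤ a x) → (∀ x, 0 < θ x) →
    ∀ (σ₁ : ℝ) (N : ℕ) (Ψ : (n : ℕ) → HardSphereFlow G3 (hsDiameter σ₁ N) n) (ν : ℝ), 0 < ν →
    ∀ X : (n : ℕ) → Config n (Fin 3) T3 → ℝ × V3 × ℝ, (∀ n, Measurable (X n)) →
    ∀ F : ℝ × V3 × ℝ → ℝ, LipschitzWith 1 F → (∀ p, |F p| ≤ 1) →
    ∀ (c : ℝ × V3 × ℝ) (B : ℝ), 0 ≤ B →
      (∑' n, ENNReal.ofReal (countWeight σ₁ (localGibbsProfile a u θ) ν N n) *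
          ∫⁻ z, ENNReal.ofReal (dist (X n z) c ^ 2)
            ∂(particleLaw (Ψ n) (canonicalDensity G3 (hsDiameter σ₁ N) n (localGibbsProfile a u θ))) ≤
        ENNReal.ofReal B) →
      wMean (canonicalWeights σ₁ (localGibbsProfile a u θ) N)
          (fun n => (canonicalMean σ₁ (localGibbsProfile a u θ) N n (Ψ n) (fun z => F (X n z))) ^ 2) ν -
        wMean (canonicalWeights σ₁ (localGibbsProfile a u θ) N)
          (fun n => canonicalMean σ₁ (localGibbsProfile a u θ) N n (Ψ n) (fun z => F (X n z))) ν ^ 2 ≤ B :=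
  fun _a _θ _u ha hθ hu ha0 hθ0 σ₁ N Ψ _ν hν X hX _F hF hFb c _B hB hmsq =>
    wVar_canonicalMean_le_of_msq' ha hθ hu ha0 hθ0 σ₁ N Ψ hν X hX hF hFb c hB hmsq

end

end Summit.AtomisticToContinuum.HydrodynamicLimit.Theorems.LightConeInLawSVC.Var
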